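import Mathlib.MeasureTheory.Constructions.UnitInterval
import Mathlib.MeasureTheory.Constructions.Pi
import Mathlib.MeasureTheory.Measure.Prod
import HarnessLib

/-!
# Chains of random maps driven by independent uniform variables

A small generic layer for processes of the form
`ω^{k+1} = f_k(ω^k, U_k)`, `U_0, U_1, …` independent uniform variables on `[0, 1]`, independent of
`ω^0` — the shape of the configuration chains of Grimmett–Manolescu (PTRF 159 (2014) §6.2:
"`ω^k = U_k ∘ ⋯ ∘ U_1(ω^0)` […] The family `(ω^k : k ≥ 0)` is a sequence of configurations on the
`G^k` with associated law denoted `P`. Note that `P` is given in terms of the law of `ω^0`, and of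
the randomizations contributing to the `U_i`. The marginal law of `ω^k` under `P` is `P_{G^k}`")
when each `U_i` is realised by the star–triangle maps of
`Literature.Probability.Percolation.StarTriangleKernels`.

* `RandomMapChain.run n f a u` — the state after running `f 0, …, f (n-1)` from `a` with the
  uniform variables `u : Fin n → [0, 1]`; `measurable_run`.
* `RandomMapChain.map_run` — **the marginal law**: if `(μ_k ⊗ U).map f_k = μ_{k+1}` for every
  `k`, then under `μ_0 ⊗ U^{⊗ n}` the final state has law `μ_n` (proof: peel off the first
  uniform variable with `measurePreserving_piFinSuccAbove`, reassociate, induct).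
* `RandomMapChain.prod_inter_le` — the elementary conditional bound used for "the randomization
  at a designated later step succeeds with probability at most `c`, whatever happened before":
  `(μ ⊗ ν)((S × Y) ∩ H) ≤ c · μ S` when every section of `H` over `S` has `ν`-mass `≤ c`.
* `RandomMapChain.chain n f a u`, `map_chain` — the same chain and marginal law with every step
  driven by a sample of an arbitrary probability space `(S, ν)` (to nest chains: a track exchange
  is a chain of star–triangle moves, `U_k` a chain of track exchanges, GM14 (6.8)); `before n f a u k`
  is the state just before step `k` (`before_zero`, `before_succ`, `measurable_before`).
* `RandomMapChain.measure_forall_before_mem_le` — **product bound along a chain**: if at every step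
  `k` the pair (state before the step, driving sample) is required to lie in a measurable set
  `B_k` all of whose sections have `ν`-mass `≤ c_k`, the probability that this happens at every
  step is `≤ ∏_k c_k`, for every initial law (induction on the first step with `prod_inter_le`;
  this is the form in which GM14's Bernoulli family `(Y^k_n)`, "constructed step by step", is
  dominated: Lemma 6.6 and the hypothesis of Lemma 6.7).

## References

* G. R. Grimmett, I. Manolescu, PTRF 159 (2014) 273–327, arXiv:1204.0505, §5.3 and §6.2 (the
  random operators `Σ_j`, `U_k` and the law `P` of the configuration chain).
-/

noncomputable section

namespace Literature.Probability.Percolation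

namespace RandomMapChain

open MeasureTheory Set

variable {A : Type*}

/-- Run the maps `f 0, …, f (n-1)` in order from the state `a`, feeding the `k`-th uniform
variable to the `k`-th map. [folklore] -/
def run : (n : ℕ) → (Fin n → A → unitInterval → A) → A → (Fin n → unitInterval) → A
  | 0, _, a, _ => a
  | n + 1, f, a, u => run n (fun k => f k.succ) (f 0 a (u 0)) (fun k => u k.succ)

/-- No step: the state is unchanged. [folklore] -/
@[simp] theorem run_zero (f : Fin 0 → A → unitInterval → A) (a : A) (u : Fin 0 → unitInterval) :
    run 0 f a u = a := rfl

/-- Peeling off the first step. [folklore] -/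
theorem run_succ (n : ℕ) (f : Fin (n + 1) → A → unitInterval → A) (a : A) (u : Fin (n + 1) → unitInterval) :
    run (n + 1) f a u = run n (fun k => f k.succ) (f 0 a (u 0)) (fun k => u k.succ) := rfl

variable [MeasurableSpace A]

/-- The run is jointly measurable in the initial state and the uniform variables. [folklore] -/
theorem measurable_run : ∀ (n : ℕ) (f : Fin n → A → unitInterval → A),
    (∀ k, Measurable (Function.uncurry (f k))) →
    Measurable fun x : A × (Fin n → unitInterval) => run n f x.1 x.2
  | 0, _, _ => measurable_fst
  | n + 1, f, hf => by
    have ih := measurable_run n (fun k => f k.succ) (fun k => hf k.succ)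
    have h1 : Measurable fun x : A × (Fin (n + 1) → unitInterval) =>
        (f 0 x.1 (x.2 0), fun k : Fin n => x.2 k.succ) :=
      ((hf 0).comp (measurable_fst.prodMk ((measurable_pi_apply 0).comp measurable_snd))).prodMk
        (measurable_pi_lambda _ fun k => (measurable_pi_apply _).comp measurable_snd)
    exact ih.comp h1

/-- **The law of a chain of random maps.** If the `k`-th map sends `μ_k ⊗ U` to `μ_{k+1}`, then,
started from `μ_0` and fed independent uniform variables, the state after `n` steps has law
`μ_n`. [folklore] -/
theorem map_run : ∀ (n : ℕ) (f : Fin n → A → unitInterval → A)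
    (_hf : ∀ k, Measurable (Function.uncurry (f k))) (μ : Fin (n + 1) → Measure A)
    [∀ k, IsProbabilityMeasure (μ k)],
    (∀ k : Fin n, ((μ k.castSucc).prod (volume : Measure unitInterval)).map
        (Function.uncurry (f k)) = μ k.succ) →
    ((μ 0).prod (Measure.pi fun _ : Fin n => (volume : Measure unitInterval))).map
        (fun x : A × (Fin n → unitInterval) => run n f x.1 x.2) = μ (Fin.last n)
  | 0, f, _, μ, _, _ => by
    simp only [run_zero]
    rw [Measure.map_fst_prod, measure_univ, one_smul]
    rfl
  | n + 1, f, hf, μ, _, hμ => by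
    -- split off the first uniform variable
    set e := MeasurableEquiv.piFinSuccAbove (fun _ : Fin (n + 1) => unitInterval) 0 with he
    have hep : MeasurePreserving e (Measure.pi fun _ : Fin (n + 1) => (volume : Measure unitInterval))
        ((volume : Measure unitInterval).prod (Measure.pi fun _ : Fin n => (volume : Measure unitInterval))) :=
      measurePreserving_piFinSuccAbove (fun _ : Fin (n + 1) => (volume : Measure unitInterval)) 0
    have he_apply : ∀ u : Fin (n + 1) → unitInterval, e u = (u 0, fun k => u k.succ) := by
      intro u
      simp [he, MeasurableEquiv.piFinSuccAbove, Fin.insertNthEquiv]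
      rfl
    -- the run factors through the split
    set G : A × (unitInterval × (Fin n → unitInterval)) → A :=
      fun y => run n (fun k => f k.succ) (f 0 y.1 y.2.1) y.2.2 with hG
    have hfac : (fun x : A × (Fin (n + 1) → unitInterval) => run (n + 1) f x.1 x.2) = G ∘ Prod.map id e := by
      funext x; simp [hG, run_succ, he_apply]
    have hGm : Measurable G := by
      have ih := measurable_run n (fun k => f k.succ) (fun k => hf k.succ)
      exact ih.comp (((hf 0).comp (measurable_fst.prodMk (measurable_fst.comp measurable_snd))).prodMk
        (measurable_snd.comp measurable_snd))
    rw [hfac, ← Measure.map_map hGm (measurable_id.prodMap e.measurable),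
      ← Measure.map_prod_map _ _ measurable_id e.measurable, Measure.map_id, hep.map_eq]
    -- move the first step into the initial law
    have hG' : G = ((fun y : A × (Fin n → unitInterval) => run n (fun k => f k.succ) y.1 y.2) ∘
        (Prod.map (Function.uncurry (f 0)) id)) ∘
          (MeasurableEquiv.prodAssoc : (A × unitInterval) × (Fin n → unitInterval) ≃ᵐ _).symm := by
      funext y; rfl
    have hm : Measurable ((fun y : A × (Fin n → unitInterval) => run n (fun k => f k.succ) y.1 y.2) ∘
        (Prod.map (Function.uncurry (f 0)) id)) :=
      (measurable_run n _ fun k => hf k.succ).comp ((hf 0).prodMap measurable_id)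
    rw [hG', ← Measure.map_map hm MeasurableEquiv.prodAssoc.symm.measurable,
      ← Measure.prodAssoc_prod, MeasurableEquiv.map_symm_map,
      ← Measure.map_map (measurable_run n _ fun k => hf k.succ) ((hf 0).prodMap measurable_id),
      ← Measure.map_prod_map _ _ (hf 0) measurable_id, Measure.map_id]
    have h0 := hμ 0
    rw [Fin.castSucc_zero] at h0
    rw [h0]
    have := map_run n (fun k => f k.succ) (fun k => hf k.succ) (fun k => μ k.succ) (fun k => ?_)
    · simpa using this
    · have h := hμ k.succ
      rw [← Fin.succ_castSucc] at h
      exact h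

/-- **Averaging a section bound**: for a product measure, if every section of `H` above a point
of `S` has `ν`-measure at most `c`, then `(μ ⊗ ν)((S × Y) ∩ H) ≤ c · μ S` — the elementary
form of "the conditional probability given the first coordinate is at most `c`". [folklore] -/
theorem prod_inter_le {X Y : Type*} [MeasurableSpace X] [MeasurableSpace Y] (μ : Measure X) (ν : Measure Y)
    [SFinite ν] {S : Set X} (hS : MeasurableSet S) {H : Set (X × Y)} (hH : MeasurableSet H) {c : ENNReal}
    (hc : ∀ x ∈ S, ν (Prod.mk x ⁻¹' H) ≤ c) : (μ.prod ν) ((S ×ˢ Set.univ) ∩ H) ≤ c * μ S := by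
  rw [Measure.prod_apply ((hS.prod MeasurableSet.univ).inter hH)]
  have hsec : ∀ x, ν (Prod.mk x ⁻¹' ((S ×ˢ Set.univ) ∩ H)) ≤ S.indicator (fun _ => c) x := by
    intro x
    by_cases hx : x ∈ S
    · rw [Set.indicator_of_mem hx]
      refine (measure_mono ?_).trans (hc x hx)
      intro y hy; exact hy.2
    · rw [Set.indicator_of_notMem hx]
      have : Prod.mk x ⁻¹' ((S ×ˢ Set.univ) ∩ H) = ∅ := by
        ext y; simp [hx]
      rw [this, measure_empty]
  calc ∫⁻ x, ν (Prod.mk x ⁻¹' ((S ×ˢ Set.univ) ∩ H)) ∂μ ≤ ∫⁻ x, S.indicator (fun _ => c) x ∂μ :=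
        lintegral_mono hsec
    _ = c * μ S := by rw [lintegral_indicator hS, setLIntegral_const]

/-! ### General driving space

The same chain with each step driven by a sample of an arbitrary probability space `(S, ν)`
instead of a uniform variable — used to nest chains (a track exchange `Σ_j` is a chain of
star–triangle moves, `U_k` a chain of track exchanges, the whole process a chain of `U_k`'s;
GM14 §6.2). -/

section General

variable {S : Type*}

omit [MeasurableSpace A] in
/-- Run the maps `f 0, …, f (n-1)` in order from the state `a`, feeding the `k`-th sample to the
`k`-th map. [folklore] -/
def chain : (n : ℕ) → (Fin n → A → S → A) → A → (Fin n → S) → A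
  | 0, _, a, _ => a
  | n + 1, f, a, u => chain n (fun k => f k.succ) (f 0 a (u 0)) (fun k => u k.succ)

omit [MeasurableSpace A] in
/-- No step: the state is unchanged. [folklore] -/
@[simp] theorem chain_zero (f : Fin 0 → A → S → A) (a : A) (u : Fin 0 → S) :
    chain 0 f a u = a := rfl

omit [MeasurableSpace A] in
/-- Peeling off the first step. [folklore] -/
theorem chain_succ (n : ℕ) (f : Fin (n + 1) → A → S → A) (a : A) (u : Fin (n + 1) → S) :
    chain (n + 1) f a u = chain n (fun k => f k.succ) (f 0 a (u 0)) (fun k => u k.succ) := rfl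

omit [MeasurableSpace A] in
/-- Peeling off the last step. [folklore] -/
theorem chain_succ_last : ∀ (n : ℕ) (f : Fin (n + 1) → A → S → A) (a : A) (u : Fin (n + 1) → S),
    chain (n + 1) f a u = f (Fin.last n) (chain n (fun k => f k.castSucc) a (fun k => u k.castSucc)) (u (Fin.last n))
  | 0, f, a, u => rfl
  | n + 1, f, a, u => by
    rw [chain_succ, chain_succ_last n, chain_succ]
    rfl

variable [MeasurableSpace S]

/-- The chain is jointly measurable in the initial state and the driving samples. [folklore] -/
theorem measurable_chain : ∀ (n : ℕ) (f : Fin n → A → S → A),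
    (∀ k, Measurable (Function.uncurry (f k))) →
    Measurable fun x : A × (Fin n → S) => chain n f x.1 x.2
  | 0, _, _ => measurable_fst
  | n + 1, f, hf => by
    have ih := measurable_chain n (fun k => f k.succ) (fun k => hf k.succ)
    have h1 : Measurable fun x : A × (Fin (n + 1) → S) =>
        (f 0 x.1 (x.2 0), fun k : Fin n => x.2 k.succ) :=
      ((hf 0).comp (measurable_fst.prodMk ((measurable_pi_apply 0).comp measurable_snd))).prodMk
        (measurable_pi_lambda _ fun k => (measurable_pi_apply _).comp measurable_snd)
    exact ih.comp h1

/-- **The law of a chain of random maps, general driving space.** If the `k`-th map sends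
`μ_k ⊗ ν` to `μ_{k+1}`, then, started from `μ_0` and fed independent `ν`-samples, the state after
`n` steps has law `μ_n`. [folklore] -/
theorem map_chain (ν : Measure S) [IsProbabilityMeasure ν] : ∀ (n : ℕ) (f : Fin n → A → S → A)
    (_hf : ∀ k, Measurable (Function.uncurry (f k))) (μ : Fin (n + 1) → Measure A)
    [∀ k, IsProbabilityMeasure (μ k)],
    (∀ k : Fin n, ((μ k.castSucc).prod ν).map (Function.uncurry (f k)) = μ k.succ) →
    ((μ 0).prod (Measure.pi fun _ : Fin n => ν)).map
        (fun x : A × (Fin n → S) => chain n f x.1 x.2) = μ (Fin.last n)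
  | 0, f, _, μ, _, _ => by
    simp only [chain_zero]
    rw [Measure.map_fst_prod, measure_univ, one_smul]
    rfl
  | n + 1, f, hf, μ, _, hμ => by
    -- split off the first sample
    set e := MeasurableEquiv.piFinSuccAbove (fun _ : Fin (n + 1) => S) 0 with he
    have hep : MeasurePreserving e (Measure.pi fun _ : Fin (n + 1) => ν)
        (ν.prod (Measure.pi fun _ : Fin n => ν)) :=
      measurePreserving_piFinSuccAbove (fun _ : Fin (n + 1) => ν) 0
    have he_apply : ∀ u : Fin (n + 1) → S, e u = (u 0, fun k => u k.succ) := by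
      intro u
      simp [he, MeasurableEquiv.piFinSuccAbove, Fin.insertNthEquiv]
      rfl
    -- the chain factors through the split
    set G : A × (S × (Fin n → S)) → A :=
      fun y => chain n (fun k => f k.succ) (f 0 y.1 y.2.1) y.2.2 with hG
    have hfac : (fun x : A × (Fin (n + 1) → S) => chain (n + 1) f x.1 x.2) = G ∘ Prod.map id e := by
      funext x; simp [hG, chain_succ, he_apply]
    have hGm : Measurable G := by
      have ih := measurable_chain n (fun k => f k.succ) (fun k => hf k.succ)
      exact ih.comp (((hf 0).comp (measurable_fst.prodMk (measurable_fst.comp measurable_snd))).prodMk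
        (measurable_snd.comp measurable_snd))
    rw [hfac, ← Measure.map_map hGm (measurable_id.prodMap e.measurable),
      ← Measure.map_prod_map _ _ measurable_id e.measurable, Measure.map_id, hep.map_eq]
    -- move the first step into the initial law
    have hG' : G = ((fun y : A × (Fin n → S) => chain n (fun k => f k.succ) y.1 y.2) ∘
        (Prod.map (Function.uncurry (f 0)) id)) ∘
          (MeasurableEquiv.prodAssoc : (A × S) × (Fin n → S) ≃ᵐ _).symm := by
      funext y; rfl
    have hm : Measurable ((fun y : A × (Fin n → S) => chain n (fun k => f k.succ) y.1 y.2) ∘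
        (Prod.map (Function.uncurry (f 0)) id)) :=
      (measurable_chain n _ fun k => hf k.succ).comp ((hf 0).prodMap measurable_id)
    rw [hG', ← Measure.map_map hm MeasurableEquiv.prodAssoc.symm.measurable,
      ← Measure.prodAssoc_prod, MeasurableEquiv.map_symm_map,
      ← Measure.map_map (measurable_chain n _ fun k => hf k.succ) ((hf 0).prodMap measurable_id),
      ← Measure.map_prod_map _ _ (hf 0) measurable_id, Measure.map_id]
    have h0 := hμ 0
    rw [Fin.castSucc_zero] at h0
    rw [h0]
    have := map_chain ν n (fun k => f k.succ) (fun k => hf k.succ) (fun k => μ k.succ) (fun k => ?_)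
    · simpa using this
    · have h := hμ k.succ
      rw [← Fin.succ_castSucc] at h
      exact h

/-- The state of the chain just before step `k`. [folklore] -/
def before (n : ℕ) (f : Fin n → A → S → A) (a : A) (u : Fin n → S) (k : Fin n) : A :=
  chain k.1 (fun i => f (i.castLE k.2.le)) a (fun i => u (i.castLE k.2.le))

omit [MeasurableSpace A] [MeasurableSpace S] in
/-- Before the first step the state is the initial one. [folklore] -/
@[simp] theorem before_zero (n : ℕ) (f : Fin (n + 1) → A → S → A) (a : A) (u : Fin (n + 1) → S) :
    before (n + 1) f a u 0 = a := rfl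

omit [MeasurableSpace A] [MeasurableSpace S] in
/-- The state before step `k + 1` is the state before step `k` of the chain started one step
later. [folklore] -/
theorem before_succ (n : ℕ) (f : Fin (n + 1) → A → S → A) (a : A) (u : Fin (n + 1) → S) (k : Fin n) :
    before (n + 1) f a u k.succ = before n (fun i => f i.succ) (f 0 a (u 0)) (fun i => u i.succ) k := rfl

/-- `before` is jointly measurable. [folklore] -/
theorem measurable_before (n : ℕ) (f : Fin n → A → S → A) (hf : ∀ k, Measurable (Function.uncurry (f k)))
    (k : Fin n) : Measurable fun x : A × (Fin n → S) => before n f x.1 x.2 k := by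
  unfold before
  have h := measurable_chain k.1 (fun i => f (i.castLE k.2.le)) (fun i => hf _)
  exact h.comp (measurable_fst.prodMk (measurable_pi_lambda _ fun i => (measurable_pi_apply _).comp measurable_snd))

/-- The event "at every step the (state, sample) pair lies in the prescribed set" is measurable.
[folklore] -/
theorem measurableSet_forall_before_mem (n : ℕ) (f : Fin n → A → S → A)
    (hf : ∀ k, Measurable (Function.uncurry (f k))) (B : Fin n → Set (A × S)) (hB : ∀ k, MeasurableSet (B k)) :
    MeasurableSet {x : A × (Fin n → S) | ∀ k, (before n f x.1 x.2 k, x.2 k) ∈ B k} := by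
  have h : {x : A × (Fin n → S) | ∀ k, (before n f x.1 x.2 k, x.2 k) ∈ B k} =
      ⋂ k, (fun x : A × (Fin n → S) => (before n f x.1 x.2 k, x.2 k)) ⁻¹' B k := by
    ext x; simp
  rw [h]
  exact MeasurableSet.iInter fun k =>
    ((measurable_before n f hf k).prodMk ((measurable_pi_apply k).comp measurable_snd)) (hB k)

/-- **Product bound along a chain.** If at every step the driving sample falls in a set of
`ν`-measure at most `c_k` — the set being allowed to depend measurably on the current state —
then the probability that this happens at every one of the `n` steps is at most `∏ c_k`,
whatever the initial law (GM14 §6.2, proof of Lemma 6.6: the Bernoulli family `(Y_n^k)` "may be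
constructed step by step […] by the independence of `(Y_n)` and `ω`").
[cite: GrimmettManolescu2014Isoradial, §6.2] -/
theorem measure_forall_before_mem_le (ν : Measure S) [IsProbabilityMeasure ν] :
    ∀ (n : ℕ) (f : Fin n → A → S → A) (_hf : ∀ k, Measurable (Function.uncurry (f k)))
    (B : Fin n → Set (A × S)) (_hB : ∀ k, MeasurableSet (B k)) (c : Fin n → ENNReal)
    (_hc : ∀ k a, ν (Prod.mk a ⁻¹' B k) ≤ c k) (μ : Measure A) [IsProbabilityMeasure μ],
    (μ.prod (Measure.pi fun _ : Fin n => ν))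
      {x : A × (Fin n → S) | ∀ k, (before n f x.1 x.2 k, x.2 k) ∈ B k} ≤ ∏ k, c k
  | 0, f, _, B, _, c, _, μ, _ => by
    simp only [IsEmpty.forall_iff, Set.setOf_true, Finset.univ_eq_empty, Finset.prod_empty]
    exact prob_le_one
  | n + 1, f, hf, B, hB, c, hc, μ, _ => by
    -- the event after the first step, for the shifted chain
    set f' : Fin n → A → S → A := fun i => f i.succ with hf'
    set E' : Set (A × (Fin n → S)) :=
      {y | ∀ k, (before n f' y.1 y.2 k, y.2 k) ∈ B k.succ} with hE'
    have hE'm : MeasurableSet E' :=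
      measurableSet_forall_before_mem n f' (fun k => hf k.succ) (fun k => B k.succ) fun k => hB k.succ
    have ih : ∀ (μ' : Measure A) [IsProbabilityMeasure μ'],
        (μ'.prod (Measure.pi fun _ : Fin n => ν)) E' ≤ ∏ k : Fin n, c k.succ := fun μ' _ =>
      measure_forall_before_mem_le ν n f' (fun k => hf k.succ) (fun k => B k.succ) (fun k => hB k.succ)
        (fun k => c k.succ) (fun k a => hc k.succ a) μ'
    -- split off the first sample
    set e := MeasurableEquiv.piFinSuccAbove (fun _ : Fin (n + 1) => S) 0 with he
    have hep : MeasurePreserving e (Measure.pi fun _ : Fin (n + 1) => ν)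
        (ν.prod (Measure.pi fun _ : Fin n => ν)) :=
      measurePreserving_piFinSuccAbove (fun _ : Fin (n + 1) => ν) 0
    have he_apply : ∀ u : Fin (n + 1) → S, e u = (u 0, fun k => u k.succ) := by
      intro u
      simp [he, MeasurableEquiv.piFinSuccAbove, Fin.insertNthEquiv]
      rfl
    set E₂ : Set (A × (S × (Fin n → S))) := {z | (z.1, z.2.1) ∈ B 0 ∧ (f 0 z.1 z.2.1, z.2.2) ∈ E'} with hE₂
    have hE : {x : A × (Fin (n + 1) → S) | ∀ k, (before (n + 1) f x.1 x.2 k, x.2 k) ∈ B k} =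
        Prod.map id e ⁻¹' E₂ := by
      ext ⟨a, u⟩
      simp only [Set.mem_setOf_eq, Set.mem_preimage, Prod.map_apply, id_eq, he_apply, hE₂, hE', hf',
        Fin.forall_fin_succ, before_zero, before_succ]
    have hH : MeasurableSet {w : (A × S) × (Fin n → S) | (Function.uncurry (f 0) w.1, w.2) ∈ E'} :=
      ((hf 0).comp measurable_fst |>.prodMk measurable_snd) hE'm
    have hE₂' : MeasurableEquiv.prodAssoc ⁻¹' E₂ =
        (B 0 ×ˢ Set.univ) ∩ {w : (A × S) × (Fin n → S) | (Function.uncurry (f 0) w.1, w.2) ∈ E'} := by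
      ext ⟨⟨a, s⟩, u⟩; simp [hE₂, MeasurableEquiv.prodAssoc]
    have hE₂m : MeasurableSet E₂ := by
      have h : MeasurableSet ((MeasurableEquiv.prodAssoc : (A × S) × (Fin n → S) ≃ᵐ _) ⁻¹' E₂) := by
        rw [hE₂']; exact ((hB 0).prod MeasurableSet.univ).inter hH
      exact (MeasurableEquiv.measurableSet_preimage _).1 h
    rw [hE, ← Measure.map_apply (measurable_id.prodMap e.measurable) hE₂m,
      ← Measure.map_prod_map _ _ measurable_id e.measurable, Measure.map_id, hep.map_eq,
      ← Measure.prodAssoc_prod, MeasurableEquiv.map_apply, hE₂']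
    -- condition on the first (state, sample) pair
    have hsec : ∀ w ∈ B 0, (Measure.pi fun _ : Fin n => ν)
        (Prod.mk w ⁻¹' {w : (A × S) × (Fin n → S) | (Function.uncurry (f 0) w.1, w.2) ∈ E'}) ≤ ∏ k : Fin n, c k.succ := by
      intro w _
      have h := ih (Measure.dirac (Function.uncurry (f 0) w))
      rw [Measure.dirac_prod, Measure.map_apply measurable_prodMk_left hE'm] at h
      exact h
    refine (prod_inter_le _ _ (hB 0) hH hsec).trans ?_
    have h0 : (μ.prod ν) (B 0) ≤ c 0 := by
      rw [Measure.prod_apply (hB 0)]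
      calc ∫⁻ a, ν (Prod.mk a ⁻¹' B 0) ∂μ ≤ ∫⁻ _, c 0 ∂μ := lintegral_mono fun a => hc 0 a
        _ = c 0 := by rw [lintegral_const, measure_univ, mul_one]
    calc (∏ k : Fin n, c k.succ) * (μ.prod ν) (B 0) ≤ (∏ k : Fin n, c k.succ) * c 0 := by gcongr
      _ = ∏ k, c k := by rw [Fin.prod_univ_succ, mul_comm]

end General

end RandomMapChain

end Literature.Probability.Percolation
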